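import Summits.QuantumFields.BalabanUV.T4Continuum.Support.NE3QuadRemainderGaugedEnd
import HarnessLib

/-!
# T⁴ programme, node NE3 — route Π, item Π-C-3γ″, file γ-LETTER: THE QUADRATIC LETTER OF THE LINEARISED AVERAGE FROM THE GAUGED TWO-TIER LEAF, PACKAGED —
# `GaugedTwoTier` ∧ Π-C's tower class ∧ the fibre ∧ (γ4″ as a displayed hypothesis) ⟹ `‖dirIter L (j+1) W X₀ z κ‖ ≤ C^γ·(L^{j+1}·m̂ z κ)²`,
# `m̂ := √(m² + ℓ² + (Λ∕L^{j+1})²)`, with `m̂`'s square sum = the leaf's clause (T3) — the owner's 4γ currency (`NE3DecomposedRepOfQuadLetter`'s `hφ`∕`hsq`)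

NE3 (node U1b) formalisation swarm `b2b-balaban-t4-ne3-formalise-*`, LEAF PROVER 02 (gen 8; Π-C authors' lineage); design D-ne3leaf02g8-1 §4 (Γ″); sequel of
γ-END `NE3QuadRemainderGaugedEnd.norm_dirIter_le_of_gaugedTwoTierData` (the four-term bound for given gauge data).

CONTENT (kernel; 0 def; all [folklore]): §3 `inBox_blockOf`∕`norm_le_of_boxDom` (a box-sup tier dominated by `sm` everywhere is a global sup — Euclidean division),
`pack_arith` (AM–GM packaging of the four terms into `C^γ·(M²m² + M²ℓ² + Λ²)`, pure real arithmetic), **`norm_dirIter_le_of_gaugedTwoTier`** (the END from the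
∃-leaf `GaugedTwoTier`, with a uniform majorant `sm` of the companion tier in the σ- and BCH-regimes, constants
`C^γ = 4(3+12d)³∕rho0² + 10240((4(3+12d)+2)(3·2^d)² + 2Aσ + 3Bβ((d+1)·3·2^d)²)` DISPLAYED, k-FREE given k-free `Aσ, Bβ`); §4 `sq_combined_of_gaugedTwoTier`
(the combined tier's square sum = (T3) verbatim) and **`norm_dirIter_le_combined_of_gaugedTwoTier`** (`≤ C^γ·(L^{j+1}·m̂ z κ)²`).

HONEST FRAMING.  Real bookkeeping over γ-END; `hlin` (γ4″, leaf-04-g8's `NE3LinearTowerProfile`) is a displayed HYPOTHESIS; the leaf is asserted for no pair;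
Π-C-3γ″ is NOT closed by this file alone; T-E_w♯ and NE3 are NOT proved; spine PROVED 0∕9; finite T⁴ rung (B)+1 — NOT infinite volume, NOT mass gap, NOT
`BetaPertH`, NOT Clay.  PLACEMENT: `Summits/QuantumFields/BalabanUV/`.  HONEST DEPENDENCY: continuum YM on T⁴ ⇐ BetaPertH ∧ nine spine estimates (0/9 proved);
BetaPertH ⇐ (D1) ∧ (D4) ∧ CAP+tail; G-an2-4 gates asym, D1 and NE2/3/4.
-/

set_option autoImplicit false

open scoped BigOperators Matrix.Norms.L2Operator
open NormedSpace Finset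

namespace Summit.QuantumFields.BalabanUV.T4Continuum.NE3QuadRemainderGaugedLetter

open Literature.MathematicalPhysics.QuantumFieldTheory.Balaban1983to89
open B7Prop1Explicit B7Prop2Explicit MatrixLog
open B7Prop1Local (InBox loK bondHiK)
open T4AveragingDeficitWall (IsSkewDir IsUnitaryCfg SmallField vary dirSq)
open T4AveragingDeficitWallBoundary (IsPeriodicCfg periodBox)
open AveragingDeficitPeriodicCounting (IsPeriodicDir)
open AveragingDeficitMultiLevelPrep (cavgIter LevelSmall)
open BlockAverageVaryDisc (rho0 rho0_pos)
open NE3TangentCovariantTower (dirIter)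
open NE3LinearisedAverageSup (curvSum)
open NE3GaugedTwoTierShape (GaugedTwoTierData GaugedTwoTier)
open NE3QuadRemainderGaugedEnd (norm_dirIter_le_of_gaugedTwoTierData)

noncomputable section

variable {d : ℕ} {n : Type*} [Fintype n] [DecidableEq n] [Nonempty n]

/-! ## §3 Packaging: the quadratic letter in the three currencies `(m, ℓ, Λ∕L^{j+1})` from the leaf `GaugedTwoTier` -/

omit [Fintype n] [DecidableEq n] [Nonempty n] in
/-- Every fine bond `(y, μ)` lies, together with its endpoint `y + e_μ`, in the block union of the coarse bond `(⌊y∕L^k⌋, μ)`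
(Euclidean division coordinatewise). [folklore] -/
theorem inBox_blockOf {L : ℕ} (hL : 1 ≤ L) (k : ℕ) (y : Site d) (μ : Fin d) :
    InBox (loK L k (fun i => y i / (L : ℤ) ^ k)) (bondHiK L k (fun i => y i / (L : ℤ) ^ k) μ) y
      ∧ InBox (loK L k (fun i => y i / (L : ℤ) ^ k)) (bondHiK L k (fun i => y i / (L : ℤ) ^ k) μ) (y + e μ) := by
  have hM : (0 : ℤ) < (L : ℤ) ^ k := by positivity
  have hdiv : ∀ i, ((L : ℤ) ^ k) * (y i / ((L : ℤ) ^ k)) ≤ y i ∧ y i ≤ ((L : ℤ) ^ k) * (y i / ((L : ℤ) ^ k)) + (((L : ℤ) ^ k) - 1) := by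
    intro i
    have h1 := Int.mul_ediv_add_emod (y i) ((L : ℤ) ^ k)
    have h2 := Int.emod_nonneg (y i) hM.ne'
    have h3 := Int.emod_lt_of_pos (y i) hM
    constructor <;> linarith
  refine ⟨fun i => ⟨(hdiv i).1, ?_⟩, fun i => ⟨?_, ?_⟩⟩
  · simp only [bondHiK]; split_ifs <;> linarith [(hdiv i).2, hM]
  · simp only [loK, Pi.add_apply, e_apply]; split_ifs <;> linarith [(hdiv i).1]
  · simp only [bondHiK, Pi.add_apply, e_apply]; split_ifs <;> linarith [(hdiv i).2, hM]

omit [Nonempty n] in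
/-- A box-sup majorant dominated by a constant `sm` on every coarse bond gives the GLOBAL sup `sm`. [folklore] -/
theorem norm_le_of_boxDom {L k : ℕ} (hL : 1 ≤ L) {B : Site d → Fin d → Matrix n n ℂ} {m : Site d → Fin d → ℝ} {sm : ℝ}
    (hdom : ∀ (z : Site d) (κ : Fin d) (y : Site d) (μ : Fin d), InBox (loK L k z) (bondHiK L k z κ) y →
      InBox (loK L k z) (bondHiK L k z κ) (y + e μ) → ‖B y μ‖ ≤ m z κ)
    (hms : ∀ (z : Site d) (κ : Fin d), m z κ ≤ sm) (y : Site d) (μ : Fin d) : ‖B y μ‖ ≤ sm := by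
  have h := inBox_blockOf (d := d) hL k y μ
  exact (hdom _ μ y μ h.1 h.2).trans (hms _ _)

omit [Fintype n] [DecidableEq n] [Nonempty n] in
/-- **THE PACKAGING ARITHMETIC.**  With `K, Aσ, Bβ, m, ℓ, Λ, c, δ ≥ 0`, `1 ≤ M`, `c ≤ c₀`, `1 ≤ c₀`:
`4K³∕r²·(Mm)² + 10240(4K·Mm·(ℓ+Λc) + (ℓ+Λc)²) + Aσ·M·10240(2mℓ+ℓ²) + Bβ((δ+1)c)·10240Λ(2m+2ℓ+Λ(δ+1)c)`
`≤ (4K³∕r² + 10240((4K+2)c₀² + 2Aσ + 3Bβ((δ+1)c₀)²))·(M²(m² + ℓ² + (Λ∕M)²))`. [folklore] -/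
theorem pack_arith {K r M m ℓ Λ c c₀ δ Aσ Bβ : ℝ} (hK : 0 ≤ K) (hM : 1 ≤ M) (hm : 0 ≤ m) (hℓ : 0 ≤ ℓ) (hΛ : 0 ≤ Λ)
    (hc : 0 ≤ c) (hcc : c ≤ c₀) (hc₀ : 1 ≤ c₀) (hδ : 0 ≤ δ) (hAσ : 0 ≤ Aσ) (hBβ : 0 ≤ Bβ) :
    4 * K ^ 3 / r ^ 2 * (M * m) ^ 2 + 10240 * (4 * K * M * m * (ℓ + Λ * c) + (ℓ + Λ * c) ^ 2)
        + Aσ * M * (10240 * (2 * m * ℓ + ℓ ^ 2)) + Bβ * ((δ + 1) * c) * (10240 * Λ * (2 * m + 2 * ℓ + Λ * ((δ + 1) * c)))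
      ≤ (4 * K ^ 3 / r ^ 2 + 10240 * ((4 * K + 2) * c₀ ^ 2 + 2 * Aσ + 3 * Bβ * ((δ + 1) * c₀) ^ 2))
          * (M ^ 2 * (m ^ 2 + ℓ ^ 2 + (Λ / M) ^ 2)) := by
  have hM0 : 0 < M := by linarith
  -- opaque names for the two rescaled tiers and the energy
  obtain ⟨a, haM⟩ : ∃ a : ℝ, M * m = a := ⟨_, rfl⟩
  obtain ⟨b, hbM⟩ : ∃ b : ℝ, M * ℓ = b := ⟨_, rfl⟩
  have hE' : M ^ 2 * (m ^ 2 + ℓ ^ 2 + (Λ / M) ^ 2) = a ^ 2 + b ^ 2 + Λ ^ 2 := by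
    have h1 : M ^ 2 * (Λ / M) ^ 2 = Λ ^ 2 := by
      rw [div_pow, ← mul_div_assoc, mul_div_cancel_left₀ _ (pow_ne_zero 2 hM0.ne')]
    calc M ^ 2 * (m ^ 2 + ℓ ^ 2 + (Λ / M) ^ 2) = (M * m) ^ 2 + (M * ℓ) ^ 2 + M ^ 2 * (Λ / M) ^ 2 := by ring
      _ = a ^ 2 + b ^ 2 + Λ ^ 2 := by rw [h1, haM, hbM]
  rw [hE']
  obtain ⟨E, hE⟩ : ∃ E : ℝ, a ^ 2 + b ^ 2 + Λ ^ 2 = E := ⟨_, rfl⟩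
  rw [hE]
  have ha0 : 0 ≤ a := by rw [← haM]; positivity
  have hb0 : 0 ≤ b := by rw [← hbM]; positivity
  have hma : m ≤ a := by rw [← haM]; nlinarith only [hM, hm]
  have hℓb : ℓ ≤ b := by rw [← hbM]; nlinarith only [hM, hℓ]
  have hE0 : 0 ≤ E := by rw [← hE]; positivity
  have haE : a ^ 2 ≤ E := by rw [← hE]; nlinarith only [sq_nonneg b, sq_nonneg Λ]
  -- T1
  have hT1 : 4 * K ^ 3 / r ^ 2 * (M * m) ^ 2 ≤ 4 * K ^ 3 / r ^ 2 * E := by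
    rw [haM]; exact mul_le_mul_of_nonneg_left haE (by positivity)
  -- T2
  have hq : ℓ + Λ * c ≤ b + c₀ * Λ := by nlinarith only [hℓb, hcc, hΛ]
  have hq0 : 0 ≤ ℓ + Λ * c := by positivity
  have hT2a : 4 * K * M * m * (ℓ + Λ * c) ≤ 4 * K * a ^ 2 + 2 * K * b ^ 2 + 2 * K * (c₀ ^ 2 * Λ ^ 2) := by
    have e0 : 4 * K * M * m * (ℓ + Λ * c) = 4 * K * (a * (ℓ + Λ * c)) := by rw [← haM]; ring
    have e1 : a * (ℓ + Λ * c) ≤ a * (b + c₀ * Λ) := mul_le_mul_of_nonneg_left hq ha0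
    have e2 : 2 * (a * b) ≤ a ^ 2 + b ^ 2 := by nlinarith only [sq_nonneg (a - b)]
    have e3 : 2 * (a * (c₀ * Λ)) ≤ a ^ 2 + c₀ ^ 2 * Λ ^ 2 := by nlinarith only [sq_nonneg (a - c₀ * Λ)]
    rw [e0]
    nlinarith only [e1, e2, e3, hK]
  have hT2b : (ℓ + Λ * c) ^ 2 ≤ 2 * b ^ 2 + 2 * (c₀ ^ 2 * Λ ^ 2) := by
    have h1 : (ℓ + Λ * c) ^ 2 ≤ (b + c₀ * Λ) ^ 2 := pow_le_pow_left₀ hq0 hq 2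
    nlinarith only [h1, sq_nonneg (b - c₀ * Λ)]
  have hT2 : 10240 * (4 * K * M * m * (ℓ + Λ * c) + (ℓ + Λ * c) ^ 2) ≤ 10240 * ((4 * K + 2) * c₀ ^ 2) * E := by
    have hc₀2 : 1 ≤ c₀ ^ 2 := by nlinarith only [hc₀]
    have hcoef1 : 4 * K ≤ (4 * K + 2) * c₀ ^ 2 := by nlinarith only [hK, hc₀2]
    have hcoef2 : 2 * K + 2 ≤ (4 * K + 2) * c₀ ^ 2 := by nlinarith only [hK, hc₀2]
    have hcoef3 : (2 * K + 2) * c₀ ^ 2 ≤ (4 * K + 2) * c₀ ^ 2 := by nlinarith only [hK, hc₀2]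
    have e1 := mul_le_mul_of_nonneg_right hcoef1 (sq_nonneg a)
    have e2 := mul_le_mul_of_nonneg_right hcoef2 (sq_nonneg b)
    have e3 := mul_le_mul_of_nonneg_right hcoef3 (sq_nonneg Λ)
    rw [← hE]
    nlinarith only [hT2a, hT2b, e1, e2, e3]
  -- T3
  have hT3 : Aσ * M * (10240 * (2 * m * ℓ + ℓ ^ 2)) ≤ 10240 * (2 * Aσ) * E := by
    have e0 : Aσ * M * (10240 * (2 * m * ℓ + ℓ ^ 2)) = 10240 * Aσ * (2 * (a * ℓ) + b * ℓ) := by rw [← haM, ← hbM]; ring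
    have e1 : a * ℓ ≤ a * b := mul_le_mul_of_nonneg_left hℓb ha0
    have e2 : b * ℓ ≤ b * b := mul_le_mul_of_nonneg_left hℓb hb0
    have e3 : 2 * (a * b) ≤ a ^ 2 + b ^ 2 := by nlinarith only [sq_nonneg (a - b)]
    have e4 : 2 * (a * ℓ) + b * ℓ ≤ 2 * E := by rw [← hE]; nlinarith only [e1, e2, e3, sq_nonneg Λ, sq_nonneg a]
    rw [e0]
    nlinarith only [e4, hAσ]
  -- T4
  have hT4 : Bβ * ((δ + 1) * c) * (10240 * Λ * (2 * m + 2 * ℓ + Λ * ((δ + 1) * c)))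
      ≤ 10240 * (3 * Bβ * ((δ + 1) * c₀) ^ 2) * E := by
    obtain ⟨c', hc'⟩ : ∃ c' : ℝ, (δ + 1) * c = c' := ⟨_, rfl⟩
    obtain ⟨c₁, hc₁'⟩ : ∃ c₁ : ℝ, (δ + 1) * c₀ = c₁ := ⟨_, rfl⟩
    have hc'0 : 0 ≤ c' := by rw [← hc']; positivity
    have hc'1 : c' ≤ c₁ := by rw [← hc', ← hc₁']; exact mul_le_mul_of_nonneg_left hcc (by linarith)
    have hc₁1 : 1 ≤ c₁ := by rw [← hc₁']; nlinarith only [hδ, hc₀]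
    rw [hc', hc₁']
    have h1 : Λ * (2 * m + 2 * ℓ + Λ * c') ≤ (2 + c₁) * E := by
      have e1 : Λ * (2 * m) ≤ Λ ^ 2 + a ^ 2 := by nlinarith only [sq_nonneg (Λ - m), hma, hm, ha0]
      have e2 : Λ * (2 * ℓ) ≤ Λ ^ 2 + b ^ 2 := by nlinarith only [sq_nonneg (Λ - ℓ), hℓb, hℓ, hb0]
      have e3 : Λ * (Λ * c') ≤ c₁ * Λ ^ 2 := by nlinarith only [sq_nonneg Λ, hc'1]
      rw [← hE]
      nlinarith only [e1, e2, e3, sq_nonneg a, sq_nonneg b, sq_nonneg Λ, hc₁1]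
    have h2 : (2 + c₁) * E ≤ 3 * c₁ * E := mul_le_mul_of_nonneg_right (by linarith) hE0
    have h3 : Bβ * c' ≤ Bβ * c₁ := mul_le_mul_of_nonneg_left hc'1 hBβ
    have h4 : 0 ≤ 10240 * Λ * (2 * m + 2 * ℓ + Λ * c') := by positivity
    calc Bβ * c' * (10240 * Λ * (2 * m + 2 * ℓ + Λ * c'))
        ≤ Bβ * c₁ * (10240 * Λ * (2 * m + 2 * ℓ + Λ * c')) := mul_le_mul_of_nonneg_right h3 h4
      _ = 10240 * (Bβ * c₁) * (Λ * (2 * m + 2 * ℓ + Λ * c')) := by ring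
      _ ≤ 10240 * (Bβ * c₁) * (3 * c₁ * E) := mul_le_mul_of_nonneg_left (h1.trans h2) (by positivity)
      _ = 10240 * (3 * Bβ * c₁ ^ 2) * E := by ring
  -- sum
  have hsum := add_le_add (add_le_add (add_le_add hT1 hT2) hT3) hT4
  have hre : 4 * K ^ 3 / r ^ 2 * E + 10240 * ((4 * K + 2) * c₀ ^ 2) * E + 10240 * (2 * Aσ) * E
        + 10240 * (3 * Bβ * ((δ + 1) * c₀) ^ 2) * E
      = (4 * K ^ 3 / r ^ 2 + 10240 * ((4 * K + 2) * c₀ ^ 2 + 2 * Aσ + 3 * Bβ * ((δ + 1) * c₀) ^ 2)) * E := by ring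
  linarith only [hsum, hre]

/-- **Π-C-3γ″ END — THE QUADRATIC LETTER OF THE LINEARISED AVERAGE OF THE RELATIVE FIELD ON THE FIBRE, FROM THE LEAF `GaugedTwoTier`, IN THE
THREE CURRENCIES `(m, ℓ, Λ∕L^{j+1})`.**  Setting: Π-C's tower class at `W`; `X₀` skew periodic of sup `s₀` in the σ-regime with the fibre
equation `cavgIter (j+1) (W·e^{X₀}) = cavgIter (j+1) W`; the varied configuration in the class with radius `x′`; the leaf
`GaugedTwoTier L N (j+1) W X₀ prof S m ℓ Λ C` (profile `0 ≤ prof ≤ 1`); a uniform majorant `sm` of the companion tier `m` in the σ- and BCH-regimes;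
and the profile letter `hlin` of the linearised average at `(z,κ)` (γ4″, constants `Aσ, Bβ ≥ 0`).  Then, with `M = L^{j+1}`,
`‖dirIter L (j+1) W X₀ z κ‖ ≤ C^γ · M²·(m z κ² + ℓ z κ² + (Λ z κ∕M)²)`,
`C^γ = 4(3+12d)³∕rho0² + 10240((4(3+12d)+2)(3·2^d)² + 2Aσ + 3Bβ((d+1)·3·2^d)²)` — DISPLAYED, `k`-FREE given `k`-free `Aσ, Bβ`. [folklore] -/
theorem norm_dirIter_le_of_gaugedTwoTier {L N j : ℕ} [NeZero N] (hL : 2 ≤ L) {W : Site d → Fin d → (Matrix n n ℂ)ˣ} {x : ℝ}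
    (hWu : IsUnitaryCfg W) (hWP : IsPeriodicCfg W ((L ^ (j + 1) * N : ℕ) : ℤ)) (hx : 0 ≤ x) (hsm : LevelSmall d L (j + 1) x)
    (hWx : SmallField W x) (hA : curvSum d L (j + 1) x ≤ 2 / 3 * L)
    {X₀ : Site d → Fin d → Matrix n n ℂ} (hX₀s : IsSkewDir X₀) (hX₀P : IsPeriodicDir X₀ ((L ^ (j + 1) * N : ℕ) : ℤ))
    {s₀ : ℝ} (hs₀ : 0 ≤ s₀) (hX₀ : ∀ (y : Site d) (μ : Fin d), ‖X₀ y μ‖ ≤ s₀) (hσ₀ : 4 * (3 + 12 * (d : ℝ)) ^ 2 * (L : ℝ) ^ (j + 1) * s₀ ≤ rho0 d L ^ 2)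
    (hfib : cavgIter L (j + 1) (vary W X₀ 1) = cavgIter L (j + 1) W)
    {x' : ℝ} (hx' : 0 ≤ x') (hsm' : LevelSmall d L j x') (hAx' : SmallField (vary W X₀ 1) x')
    {prof : Site d → ℝ} (hp0 : ∀ v, 0 ≤ prof v) (hp1 : ∀ v, prof v ≤ 1)
    {S : Site d → Fin d → Finset (Site d)} {m ℓ Λ : Site d → Fin d → ℝ} {C : ℝ}
    (hG : GaugedTwoTier L N (j + 1) W X₀ prof S m ℓ Λ C)
    {sm : ℝ} (hms : ∀ (z : Site d) (κ : Fin d), m z κ ≤ sm)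
    (hσsm : 4 * (3 + 12 * (d : ℝ)) ^ 2 * (L : ℝ) ^ (j + 1) * sm ≤ rho0 d L ^ 2) (hsm8 : 2 * (3 + 12 * (d : ℝ)) * (L : ℝ) ^ (j + 1) * sm ≤ 1 / 8192)
    (z : Site d) (κ : Fin d) {Aσ Bβ : ℝ} (hAσ : 0 ≤ Aσ) (hBβ : 0 ≤ Bβ)
    (hlin : ∀ (Y : Site d → Fin d → Matrix n n ℂ) (S' : Finset (Site d)) (σ β : ℝ), IsSkewDir Y →
      IsPeriodicDir Y ((L ^ (j + 1) * N : ℕ) : ℤ) → 0 ≤ σ → 0 ≤ β →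
      (∀ (y : Site d) (μ : Fin d), InBox (loK L (j + 1) z) (bondHiK L (j + 1) z κ) y → InBox (loK L (j + 1) z) (bondHiK L (j + 1) z κ) (y + e μ) →
        ‖Y y μ‖ ≤ σ + β * ∑ c ∈ S', prof (y - c)) →
      ‖dirIter L (j + 1) W Y z κ‖ ≤ Aσ * (L : ℝ) ^ (j + 1) * σ + Bβ * S'.card * β) :
    ‖dirIter L (j + 1) W X₀ z κ‖
      ≤ (4 * (3 + 12 * (d : ℝ)) ^ 3 / rho0 d L ^ 2
            + 10240 * ((4 * (3 + 12 * (d : ℝ)) + 2) * (3 * 2 ^ d) ^ 2 + 2 * Aσ + 3 * Bβ * ((d + 1) * (3 * 2 ^ d)) ^ 2))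
          * (((L : ℝ) ^ (j + 1)) ^ 2 * (m z κ ^ 2 + ℓ z κ ^ 2 + (Λ z κ / (L : ℝ) ^ (j + 1)) ^ 2)) := by
  have hL1 : 1 ≤ L := by omega
  obtain ⟨lam, B, hD⟩ := hG.data
  obtain ⟨hm, hℓ, hΛ, hcard, -⟩ := hG.nonneg z κ
  have hm0 : 0 ≤ sm := (hm).trans (hms z κ)
  -- the companion's global sup from the box-sup tier
  have hB : ∀ (y : Site d) (μ : Fin d), ‖B y μ‖ ≤ sm := norm_le_of_boxDom hL1 hD.dom_B hms
  have hM1 : (1 : ℝ) ≤ (L : ℝ) ^ (j + 1) := one_le_pow₀ (by exact_mod_cast hL1)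
  have hM0 : (0 : ℝ) < (L : ℝ) ^ (j + 1) := by positivity
  -- per-bond regimes on `m z κ` from the uniform ones
  have hK0 : (0 : ℝ) ≤ 3 + 12 * (d : ℝ) := by positivity
  have hσm : 4 * (3 + 12 * (d : ℝ)) ^ 2 * (L : ℝ) ^ (j + 1) * m z κ ≤ rho0 d L ^ 2 :=
    (mul_le_mul_of_nonneg_left (hms z κ) (by positivity)).trans hσsm
  have hm' : 2 * (3 + 12 * (d : ℝ)) * (L : ℝ) ^ (j + 1) * m z κ ≤ 1 / 8192 :=
    (mul_le_mul_of_nonneg_left (hms z κ) (by positivity)).trans hsm8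
  have h := norm_dirIter_le_of_gaugedTwoTierData hL hWu hWP hx hsm hWx hA hX₀s hX₀P hs₀ hX₀ hσ₀ hfib hx' hsm' hAx' hp0 hp1 hD hm0 hB hσsm
    z κ hm hℓ hΛ hσm hm' hBβ hlin
  have hc : ((S z κ).card : ℝ) ≤ 3 * 2 ^ d := by exact_mod_cast hcard
  have hc₀ : (1 : ℝ) ≤ 3 * 2 ^ d := by
    have : (1 : ℝ) ≤ 2 ^ d := one_le_pow₀ (by norm_num)
    linarith
  exact h.trans (pack_arith (r := rho0 d L) hK0 hM1 hm hℓ hΛ (Nat.cast_nonneg _) hc hc₀ (Nat.cast_nonneg d) hAσ hBβ)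

/-! ## §4 The junction to the owner's single-weight quadratic letter (4γ `NE3DecomposedRepOfQuadLetter`): the combined tier
`m̂ := √(m² + ℓ² + (Λ∕L^k)²)` -/

omit [Nonempty n] in
/-- **SQUARE-SUMMABILITY OF THE COMBINED TIER** `m̂ z κ := √(m z κ² + ℓ z κ² + (Λ z κ∕L^k)²)`: verbatim the leaf's clause (T3), since `m̂² = m² + ℓ² + (Λ∕L^k)²`.
This is 4γ's `hsq` with the weight `m̂`. [folklore] -/
theorem sq_combined_of_gaugedTwoTier {L N k : ℕ} {W : Site d → Fin d → (Matrix n n ℂ)ˣ} {X₀ : Site d → Fin d → Matrix n n ℂ} {prof : Site d → ℝ}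
    {S : Site d → Fin d → Finset (Site d)} {m ℓ Λ : Site d → Fin d → ℝ} {C : ℝ} (hG : GaugedTwoTier L N k W X₀ prof S m ℓ Λ C) :
    ((L : ℝ) ^ k) ^ d * ∑ z ∈ periodBox (d := d) N, ∑ κ : Fin d, Real.sqrt (m z κ ^ 2 + ℓ z κ ^ 2 + (Λ z κ / (L : ℝ) ^ k) ^ 2) ^ 2
      ≤ C ^ 2 * dirSq X₀ (periodBox (d := d) (N * L ^ k)) := by
  have h := hG.sq
  have hre : ∑ z ∈ periodBox (d := d) N, ∑ κ : Fin d, Real.sqrt (m z κ ^ 2 + ℓ z κ ^ 2 + (Λ z κ / (L : ℝ) ^ k) ^ 2) ^ 2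
      = ∑ z ∈ periodBox (d := d) N, ∑ κ : Fin d, (m z κ ^ 2 + ℓ z κ ^ 2 + (Λ z κ / (L : ℝ) ^ k) ^ 2) := by
    refine Finset.sum_congr rfl fun z _ => Finset.sum_congr rfl fun κ _ => ?_
    exact Real.sq_sqrt (by positivity)
  rw [hre]; exact h

/-- **Π-C-3γ″ END IN THE OWNER'S 4γ CURRENCY**: under the hypotheses of `norm_dirIter_le_of_gaugedTwoTier`,
`‖dirIter L (j+1) W X₀ z κ‖ ≤ C^γ·(L^{j+1}·m̂ z κ)²` with the combined tier `m̂ z κ := √(m z κ² + ℓ z κ² + (Λ z κ∕L^{j+1})²)` — 4γ's `hφ` with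
`C₂ := C^γ`, `m := m̂` (and `hsq` = `sq_combined_of_gaugedTwoTier`, `hm0` = `Real.sqrt_nonneg`). [folklore] -/
theorem norm_dirIter_le_combined_of_gaugedTwoTier {L N j : ℕ} [NeZero N] (hL : 2 ≤ L) {W : Site d → Fin d → (Matrix n n ℂ)ˣ} {x : ℝ}
    (hWu : IsUnitaryCfg W) (hWP : IsPeriodicCfg W ((L ^ (j + 1) * N : ℕ) : ℤ)) (hx : 0 ≤ x) (hsm : LevelSmall d L (j + 1) x)
    (hWx : SmallField W x) (hA : curvSum d L (j + 1) x ≤ 2 / 3 * L)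
    {X₀ : Site d → Fin d → Matrix n n ℂ} (hX₀s : IsSkewDir X₀) (hX₀P : IsPeriodicDir X₀ ((L ^ (j + 1) * N : ℕ) : ℤ))
    {s₀ : ℝ} (hs₀ : 0 ≤ s₀) (hX₀ : ∀ (y : Site d) (μ : Fin d), ‖X₀ y μ‖ ≤ s₀) (hσ₀ : 4 * (3 + 12 * (d : ℝ)) ^ 2 * (L : ℝ) ^ (j + 1) * s₀ ≤ rho0 d L ^ 2)
    (hfib : cavgIter L (j + 1) (vary W X₀ 1) = cavgIter L (j + 1) W)
    {x' : ℝ} (hx' : 0 ≤ x') (hsm' : LevelSmall d L j x') (hAx' : SmallField (vary W X₀ 1) x')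
    {prof : Site d → ℝ} (hp0 : ∀ v, 0 ≤ prof v) (hp1 : ∀ v, prof v ≤ 1)
    {S : Site d → Fin d → Finset (Site d)} {m ℓ Λ : Site d → Fin d → ℝ} {C : ℝ}
    (hG : GaugedTwoTier L N (j + 1) W X₀ prof S m ℓ Λ C)
    {sm : ℝ} (hms : ∀ (z : Site d) (κ : Fin d), m z κ ≤ sm)
    (hσsm : 4 * (3 + 12 * (d : ℝ)) ^ 2 * (L : ℝ) ^ (j + 1) * sm ≤ rho0 d L ^ 2) (hsm8 : 2 * (3 + 12 * (d : ℝ)) * (L : ℝ) ^ (j + 1) * sm ≤ 1 / 8192)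
    (z : Site d) (κ : Fin d) {Aσ Bβ : ℝ} (hAσ : 0 ≤ Aσ) (hBβ : 0 ≤ Bβ)
    (hlin : ∀ (Y : Site d → Fin d → Matrix n n ℂ) (S' : Finset (Site d)) (σ β : ℝ), IsSkewDir Y →
      IsPeriodicDir Y ((L ^ (j + 1) * N : ℕ) : ℤ) → 0 ≤ σ → 0 ≤ β →
      (∀ (y : Site d) (μ : Fin d), InBox (loK L (j + 1) z) (bondHiK L (j + 1) z κ) y → InBox (loK L (j + 1) z) (bondHiK L (j + 1) z κ) (y + e μ) →
        ‖Y y μ‖ ≤ σ + β * ∑ c ∈ S', prof (y - c)) →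
      ‖dirIter L (j + 1) W Y z κ‖ ≤ Aσ * (L : ℝ) ^ (j + 1) * σ + Bβ * S'.card * β) :
    ‖dirIter L (j + 1) W X₀ z κ‖
      ≤ (4 * (3 + 12 * (d : ℝ)) ^ 3 / rho0 d L ^ 2
            + 10240 * ((4 * (3 + 12 * (d : ℝ)) + 2) * (3 * 2 ^ d) ^ 2 + 2 * Aσ + 3 * Bβ * ((d + 1) * (3 * 2 ^ d)) ^ 2))
          * ((L : ℝ) ^ (j + 1) * Real.sqrt (m z κ ^ 2 + ℓ z κ ^ 2 + (Λ z κ / (L : ℝ) ^ (j + 1)) ^ 2)) ^ 2 := by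
  have hsq : ((L : ℝ) ^ (j + 1) * Real.sqrt (m z κ ^ 2 + ℓ z κ ^ 2 + (Λ z κ / (L : ℝ) ^ (j + 1)) ^ 2)) ^ 2
      = ((L : ℝ) ^ (j + 1)) ^ 2 * (m z κ ^ 2 + ℓ z κ ^ 2 + (Λ z κ / (L : ℝ) ^ (j + 1)) ^ 2) := by
    rw [mul_pow, Real.sq_sqrt (by positivity)]
  rw [hsq]
  exact norm_dirIter_le_of_gaugedTwoTier hL hWu hWP hx hsm hWx hA hX₀s hX₀P hs₀ hX₀ hσ₀ hfib hx' hsm' hAx' hp0 hp1 hG hms hσsm hsm8 z κ hAσ hBβ hlin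

end

end Summit.QuantumFields.BalabanUV.T4Continuum.NE3QuadRemainderGaugedLetter
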